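import Mathlib
import HarnessLib
import Literature.NumberTheory.GaloisRepresentations.ResidualGaloisRep
import Literature.NumberTheory.GaloisRepresentations.ResiduallyReducibleOfStableLine

/-!
# Stub `stub_residualDet` (line `local_clause_cut`, crux `EmptyWeightCore`, stmt-Langlands-17008)

For a rank-two `ρ : Γ_F → GL₂(ℚ̄_p)` and the tree's CHOSEN residual representation
`ρ.residualRep : Γ_F → GL₂(ℤ̄_p/𝔪)` (a semisimplified reduction; no junk value in rank `2` by
`FramedGaloisRep.isResidualRepOf_residualRep_fin_two`), the residual determinant is the reduction
of the determinant: if `x ∈ ℤ̄_p` equals `det ρ(g)` in `ℚ̄_p`, then `det ρ̄(g) = x mod 𝔪`.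

Proof.  `IsResidualRepOf.hasResidualCharpolys` gives `P ∈ ℤ̄_p[X]` with
`P ↦ det(X - ρ(g))` in `ℚ̄_p[X]` and `P ↦ det(X - ρ̄(g))` in `(ℤ̄_p/𝔪)[X]`; compare constant
coefficients with Mathlib `Matrix.det_eq_sign_charpoly_coeff` (`det M = (-1)^2 · χ_M(0)`):
`P(0) = det ρ(g) = x` in `ℚ̄_p`, hence `P(0) = x` in `ℤ̄_p` (`ℤ̄_p ↪ ℚ̄_p`), and
`det ρ̄(g) = P(0) mod 𝔪 = x mod 𝔪`.

Reference: Darmon–Diamond–Taylor, *Fermat's Last Theorem* (1995), §2.1, Prop. 2.6 (b) (the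
semisimplified reduction is determined by the reduced characteristic polynomials).  No `sorry`,
no new definitions.
-/

-- project-wide option (lakefile weak.linter.dupNamespace); `Summit.Langlands.Langlands` is mandated
set_option linter.dupNamespace false

noncomputable section

namespace Summit.Langlands.Langlands.Cruxes.EmptyWeightCore.LocalClauseCut

open Literature.NumberTheory.GaloisRepresentations Field IsDedekindDomain NumberField

section ResidualDetHelpers

variable {F : Type*} [Field F] {O : ValuationSubring F} {n : ℕ}
variable {G : Type*} [Group G] {k : Type*} [Field k]

/-- **Residual characteristic polynomials give residual determinants.**  If `τ` has the residual
characteristic polynomials of `ρ` along `ι : O/𝔪 →+* k` (`HasResidualCharpolys ι ρ τ`) and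
`x ∈ O` equals `det ρ(g)` in `F`, then `det τ(g) = ι (x mod 𝔪)` (constant coefficients of the
characteristic polynomials, Mathlib `Matrix.det_eq_sign_charpoly_coeff`). [folklore] -/
theorem residualDet_of_hasResidualCharpolys {ι : IsLocalRing.ResidueField O →+* k}
    {ρ : G →* GL (Fin n) F} {τ : G →* GL (Fin n) k} (h : HasResidualCharpolys ι ρ τ) (g : G)
    (x : O) (hx : (x : F) = ((ρ g : GL (Fin n) F) : Matrix (Fin n) (Fin n) F).det) :
    ((τ g : GL (Fin n) k) : Matrix (Fin n) (Fin n) k).det = ι (IsLocalRing.residue O x) := by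
  obtain ⟨P, hP, hP'⟩ := h g
  -- the constant coefficient of `P` is `(-1)^n x`
  have h0 : (((-1) ^ n * P.coeff 0 : O) : F) = (x : F) := by
    rw [hx, Matrix.det_eq_sign_charpoly_coeff, Fintype.card_fin, ← hP, Polynomial.coeff_map,
      ValuationSubring.coe_subtype]
    push_cast
    rfl
  have h0' : (-1) ^ n * P.coeff 0 = x := Subtype.val_injective h0
  rw [Matrix.det_eq_sign_charpoly_coeff, Fintype.card_fin, ← hP', Polynomial.coeff_map, ← h0']
  simp

end ResidualDetHelpers

/-- **STUB C — the residual determinant is the reduction of the determinant** (rank 2, the tree's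
chosen `residualRep`, no junk value in rank 2 by `isResidualRepOf_residualRep_fin_two`): if
`x ∈ ℤ̄_p` has `x = det ρ(g)` in `ℚ̄_p`, then `det ρ̄(g) = x mod 𝔪`
(`IsResidualRepOf.hasResidualCharpolys`, constant coefficients of the characteristic polynomials).
[cite: DarmonDiamondTaylor1995, §2.1, Prop. 2.6] -/
theorem stub_residualDet :
    ∀ (F : Type) [Field F] [NumberField F] (p : ℕ) [Fact p.Prime]
      (ρ : FramedGaloisRep F (PadicAlgCl p) 2) (g : absoluteGaloisGroup F)
      (x : padicAlgClIntegers p),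
      (x : PadicAlgCl p) = (ρ g).val.det →
      (ρ.residualRep g).val.det = IsLocalRing.residue (padicAlgClIntegers p) x := by
  intro F _ _ p _ ρ g x hx
  exact residualDet_of_hasResidualCharpolys
    ρ.isResidualRepOf_residualRep_fin_two.hasResidualCharpolys g x hx

end Summit.Langlands.Langlands.Cruxes.EmptyWeightCore.LocalClauseCut

end
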